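import Literature.MathematicalPhysics.QuantumLattice.FermiRG.BGM2003Sectors
import Literature.MathematicalPhysics.QuantumLattice.AnisotropicSectors
import Mathlib.Analysis.Calculus.IteratedDeriv.Defs
import Mathlib.MeasureTheory.Integral.Bochner.Basic
import Mathlib.MeasureTheory.Constructions.Pi
import HarnessLib

/-!
# Benfatto–Giuliani–Mastropietro 2003, §2.1/§2.3 and §6: the single-scale sector propagator `g^{(h)}_ω`
(3.20) for a general symmetric dispersion and its decay Lemma 2.1 [lm3.1] (3.22); the jellium operators
`D_i(t)` (7.5) and the dimensional bound Lemma 6.1 [lm7.1] (7.11)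

Topic `Literature/MathematicalPhysics/QuantumLattice/FermiRG`; statements-first typing (D-0069 (2) typer
wave, seat t3, wave-optional rows `BGM03.L2.1` / `BGM03.L6.1`, licences F-013 / F-020) of

* G. Benfatto, A. Giuliani, V. Mastropietro, *Low temperature analysis of two-dimensional Fermi systems with
  symmetric Fermi surface*, Ann. Henri Poincaré 4 (2003) 137–193, arXiv:cond-mat/0207210
  [BenfattoGiulianiMastropietro2003]. Locators `p.N (Ln)` = N-th 3000-character chunk (line n) of the
  materialised arXiv TeX (`lit read arxiv:cond-mat/0207210`), the chunking of `BGM2003Main` / `BGM2003Sectors`;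
  equation / lemma numbers are the printed ones (TeX labels in brackets).

Companion of the FROZEN statement files `BGM2003Sectors.lean` (F3b: `DispersionHyp`, the polar chart
`levelPoint` / `fermiPoint` / `shell`, the frame `unitNormal` / `unitTangent`, the s-sectors) and
`BGM2003Main.lean` (F3a: Theorem 1.1); neither is edited, nothing of theirs is restated.

## What is here

* **§2.1 (3.1a), (3.4), (3.7)**: the single-scale cutoff `f_h(k) = f̃_h(√(k₀² + (ε(k⃗) − μ)²))`,
  `f̃_h(t) = H₀(γ^{-h}t) − H₀(γ^{-h+1}t)`, `γ = 4`, for a GENERAL dispersion `ε` — the tree's one-variable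
  `gnShell 4 e₀ h` (`ScaleCutoffs`: ONE fixed admissible smooth `H₀`, exactly as `BGM2003Sectors` fixes BGM's
  `H₂` by the tree's `sectorWeightCirc`) composed with `√(k₀² + (ε(k⃗) − μ)²)` (`BGM2003.scaleCutoff`; the
  tree's `scaleCutoffFn` is its Hubbard instance `ε = sqDispersion`).
* **§2.3 (3.20a), (3.20), (3.21b)**: the sector cutoff `F_{h,ω}(k) = f_h(k) ζ_{h,ω}(θ)` (`θ` = the polar
  angle of `k⃗`, the tree's `polarAngle`; `ζ_{h,ω} = sectorWeightCirc n ω`, `h = −n`), READ ON THE SHELL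
  `ℬ = shell u e₀` (an indicator factor — see "conventions"), the **single-scale sector propagator**
  `g^{(h)}_ω(x) = (2π)⁻³ ∫dk e^{-i(k·x − p⃗_F(θ_{h,ω})·x⃗)} F_{h,ω}(k)/(−ik₀ + ε(k⃗) − μ)` (3.20) with the
  quasi-particle phase `e^{ip⃗_F(θ_{h,ω})·x⃗}` extracted as printed, and its reading in the frame
  `x⃗ = x'₁ n⃗(θ_{h,ω}) + x'₂ τ⃗(θ_{h,ω})` (3.21b) (`BGM2003.sectorPropagatorFrame`).
* **Lemma 2.1 [lm3.1] (3.22)** as a CLOSED NAMED FACT `BGM2003.lemma21_sectorPropagatorDecay` (D-0014;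
  proved in the paper's §7.2 by integration by parts in the anisotropic chart; unproved here):
  `|∂_{x₀}^{n₀} ∂_{x'₁}^{n₁} ∂_{x'₂}^{n₂} g^{(h)}_ω(x)| ≤ C_{N,m} γ^{3h/2} γ^{(n₀+n₁+½n₂)h} / (1 + (γ^h|x₀| + γ^h|x'₁| + γ^{h/2}|x'₂|)^N)`
  uniformly in `h ≤ 0`, `ω ∈ O_h`, `x`; the mixed partial derivative is the nested one-variable iterated
  derivative `BGM2003.mixedPartial` (for the smooth `g^{(h)}_ω` this is the classical `∂₀^{n₀}∂₁^{n₁}∂₂^{n₂}`).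
* **§6 (the rotation-invariant case)**: the jellium data `ε(k⃗) = |k⃗|²/2m`, `u(θ,e) = √(2m(μ+e))`,
  `p_F = √(2mμ)` (`jelliumDispersion`, `jelliumRadius`, `jelliumFermiMomentum`), the Fourier multipliers of the
  operators `D₁(t)`, `D₂(t)` of (7.5) (`dMultiplier₁`, `dMultiplier₂`), the propagator with `n₁` factors
  `D₁(t_j)` and `n₂` factors `D₂(s_j)` inserted (`jelliumPropagatorD`; (7.11): "`D_iⁿ` denotes the product of
  `n` factors `D_i(t_j)`, `j = 1,…,n`"), and **Lemma 6.1 [lm7.1] (7.11)** as a CLOSED NAMED FACT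
  `BGM2003.lemma61_jelliumPropagatorDecay`:
  `|∂₀^{n₀} D₁^{n₁} D₂^{n₂} g^{(h)}_ω(x)| ≤ C_{N,m} γ^{h(3/2 + n₀ + n₁ + 3n₂/2)} / (1 + [(γ^hx₀)² + (γ^hx₁)² + (γ^{h/2}x₂)²]^N)`.
* small PROVED API: `scaleCutoff ∈ [0,1]` and its scale support, `sectorCutoff = 0` off the shell,
  `mixedPartial 0 0 0 = id`, the jellium level sets `ε(u(θ,e)e⃗_r(θ)) = μ + e` and `p⃗_F(θ) = p_F e⃗_r(θ)`.

## Relation to the tree (cite, not restate)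

For the HUBBARD band dispersion the tree PROVES the order-`(0,0,0)` case of (3.22) for its own instance of
(3.20) (`SectorPropagatorDecay.sectorPropagator_decay`, BGM 2006 Lemma 2.2 (2.52), with
`SectorPropagatorSupBound.sectorPropagator` = the `ε = sqDispersion` propagator restricted to the central zone
copy by a smooth bump, no `(2π)⁻³`, no phase extraction — the modulus is the same) and the moment / `L¹` /
Gram variants (`SectorPropagatorL1`, `SectorPropagatorMoments`, `SectorPropagatorGram`,
`TorusSectorPropagatorDecay`).  Lemma 2.1 here is the printed GENERAL-dispersion statement with all
derivatives (FACT-LIST T-05 cites those files for the Hubbard instance); it stays a named fact.  A bridge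
"`BGM2003.sectorPropagator` at the Hubbard data = `(2π)⁻³ e^{-ip⃗_F·x⃗} ·` the tree's `sectorPropagator`" is
`-- TODO(bridge)` (it needs F3b's pending instantiation of `DispersionHyp` at the Hubbard band, fs-1's theorem).

## Typing conventions / deviations, stated once

* `γ = 4`, `h = −n ≤ 0` (`n : ℕ`), `γ^h = 4^{-n}`, `γ^{h/2} = 2^{-n}` (as in `BGM2003Sectors`); `ω ∈ O_h` is
  `ω < sectorCount n = 2^{n+1}`; `θ_{h,ω} = sectorCenter n ω`; `p⃗_F(θ) = fermiPoint u θ`,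
  `n⃗(θ) = unitNormal u θ 0`, `τ⃗(θ) = unitTangent u θ 0` ((3.21) is the `e = 0` frame of (A1.6)–(A1.7)).
* After (3.8a) the paper treats `k₀` AND `k⃗` as continuous variables and `∫dk⃗` as the integral over one
  Brillouin zone (p.6 L148 – p.7 L7).  For `h ≤ 0`, `f_h` is supported in `{|ε(k⃗) − μ| ≤ γ^h e₀} ⊆ {|ε − μ| ≤ e₀}`,
  which INSIDE THE ZONE is the annulus `ℬ` of App. 7.1 (A1.1) (for a lattice dispersion, `2πℤ²`-periodic on
  `ℝ²`, the literal sublevel set in `ℝ²` is the `2πℤ²`-orbit of `ℬ`).  The momentum integral is therefore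
  written over `ℝ × ℝ²` with the integrand multiplied by the indicator of `ℬ = shell u e₀` — the paper's
  `F_{h,ω}` read on `ℬ`, exactly the convention of `BGM2003Sectors` ("the sets `ℬ`, `Σ(e)`, `S_{h,ω}` are
  written as images of the polar chart … read inside `ℬ`").  Under `DispersionHyp` ((2.8b): `ε − μ` crosses
  `±e₀` transversally along rays) the product is still `C^∞` and compactly supported on `ℝ × ℝ²`.
* Mixed partials `∂_{x₀}^{n₀}∂_{x'₁}^{n₁}∂_{x'₂}^{n₂}` of a function of `(x₀, x'₁, x'₂) ∈ ℝ³` are the nested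
  one-variable `iteratedDeriv`s (innermost `x'₂`); for `C^∞` functions the order is immaterial (Schwarz).
* The operators `D_i(t)` act on fields by the Fourier multipliers of (7.5) with a charge sign `iε`, `ε = ±`;
  on the propagator each factor inserts `i · m_i(t, k⃗')` under the `k`-integral (the overall sign
  `(±1)^{n₁+n₂}` is immaterial for the modulus bound (7.11) and is fixed to `+`).  `∂₀^{n₀}` is a genuine
  `x₀`-derivative (`iteratedDeriv`).  In §6, `e⃗_r(θ) = n⃗(θ)`, `e⃗_t(θ) = τ⃗(θ)` (p.25 L45–48) and
  `x₁ = x⃗·e⃗_r(θ_{h,ω})`, `x₂ = x⃗·e⃗_t(θ_{h,ω})`.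
* Unspecified constants `C_{N,m}` depend on the model data (`ε, μ, e₀`, resp. `m, μ, e₀`) and on
  `N, n₀, n₁, n₂`; they are existentially quantified after these and are uniform in `h ≤ 0`, `ω ∈ O_h`, `x`
  (and in the interpolation parameters `t_j ∈ [0,1]` of the `D_i`), as printed.

Nothing here asserts anything about the Hubbard model, H1, K1 or K3; Theorem 1.1's counterterm `ν̂` and the
OPEN inversion `ε₀ = ε + ν̂` (F3a) are not touched.
-/

noncomputable section

open Real Set MeasureTheory

namespace Literature.MathematicalPhysics.QuantumLattice.FermiRG

namespace BGM2003

/-! ### §2.1: the single-scale cutoff `f_h(k)` for a general dispersion -/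

/-- **The single-scale cutoff as a function of `k = (k₀, k⃗)`** for the dispersion `ε` at chemical potential
`μ` (§2.1 (3.4)/(3.7), `γ = 4`, scale `h = −n`): `f_h(k) = f̃_h(√(k₀² + (ε(k⃗) − μ)²))` with
`f̃_h(t) = H₀(γ^{-h}t) − H₀(γ^{-h+1}t)` the tree's `gnShell 4 e₀ (-n)` (support `[γ^{h-2}e₀, γ^h e₀]`, p.6 L88–89).
The tree's `scaleCutoffFn e₀ μ n` is the instance `ε = sqDispersion`. [cite: BenfattoGiulianiMastropietro2003, §2.1 (3.1a), (3.4), (3.7) p.6 (L37–46, L86–120)] -/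
def scaleCutoff (ε : (Fin 2 → ℝ) → ℝ) (μ e₀ : ℝ) (n : ℕ) (p : ℝ × (Fin 2 → ℝ)) : ℝ :=
  gnShell 4 e₀ (-(n : ℤ)) (Real.sqrt (p.1 ^ 2 + (ε p.2 - μ) ^ 2))

/-- `0 ≤ f_h(k) ≤ 1`. [cite: BenfattoGiulianiMastropietro2003, §2.1 (3.4) p.6 (L86–92)] -/
theorem scaleCutoff_mem_Icc (ε : (Fin 2 → ℝ) → ℝ) (μ : ℝ) {e₀ : ℝ} (he : 0 < e₀) (n : ℕ)
    (p : ℝ × (Fin 2 → ℝ)) : scaleCutoff ε μ e₀ n p ∈ Icc (0 : ℝ) 1 :=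
  ⟨gnShell_nonneg (by norm_num) he _ (Real.sqrt_nonneg _), gnShell_le_one _ _ _ _⟩

/-- **Scale support**: `f_h(k) ≠ 0 ⟹ e₀γ^{h-2} < √(k₀² + (ε(k⃗) − μ)²) < e₀γ^h` ("support in the interval
`[γ^{h-2}e₀, γ^h e₀]`"). [cite: BenfattoGiulianiMastropietro2003, §2.1 (3.4) p.6 (L86–92)] -/
theorem mem_Ioo_of_scaleCutoff_ne_zero (ε : (Fin 2 → ℝ) → ℝ) (μ : ℝ) {e₀ : ℝ} (he : 0 < e₀) {n : ℕ}
    {p : ℝ × (Fin 2 → ℝ)} (hp : scaleCutoff ε μ e₀ n p ≠ 0) :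
    Real.sqrt (p.1 ^ 2 + (ε p.2 - μ) ^ 2) ∈
      Ioo (e₀ * (4 : ℝ) ^ (-(n : ℤ) - 2)) (e₀ * (4 : ℝ) ^ (-(n : ℤ))) :=
  mem_Ioo_of_gnShell_ne_zero (by norm_num) he hp

/-! ### §2.3: the sector cutoff `F_{h,ω}` and the sector propagator `g^{(h)}_ω` -/

/-- **The sector cutoff `F_{h,ω}(k) = f_h(k) ζ_{h,ω}(θ)`** (3.20a) — `θ` the polar angle of `k⃗` (the tree's
`polarAngle`), `ζ_{h,ω} = sectorWeightCirc n ω` ((3.11)/(3.14a), as identified in `BGM2003Sectors`) — read on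
the shell `ℬ = shell u e₀` of App. 7.1 (the indicator factor; module doc, conventions).  Its support is "the
sector of scale `h` and sector index `ω`" (p.8 L18–19), i.e. `ℝ × S_{h,ω}` sliced by `|k₀| ≤ γ^h e₀`.
[cite: BenfattoGiulianiMastropietro2003, §2.3 (3.20a) p.8 (L16–19)] -/
def sectorCutoff (ε : (Fin 2 → ℝ) → ℝ) (μ e₀ : ℝ) (u : ℝ → ℝ → ℝ) (n ω : ℕ)
    (p : ℝ × (Fin 2 → ℝ)) : ℝ :=
  (shell u e₀).indicator (fun _ => (1 : ℝ)) p.2 * scaleCutoff ε μ e₀ n p *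
    sectorWeightCirc n ω (polarAngle p.2)

/-- Off the shell `ℬ` the sector cutoff vanishes (the indicator convention). [cite: BenfattoGiulianiMastropietro2003, §2.3 (3.20a) p.8 (L16–19)] -/
theorem sectorCutoff_eq_zero_of_not_mem {ε : (Fin 2 → ℝ) → ℝ} {μ e₀ : ℝ} {u : ℝ → ℝ → ℝ} {n ω : ℕ}
    {p : ℝ × (Fin 2 → ℝ)} (hp : p.2 ∉ shell u e₀) : sectorCutoff ε μ e₀ u n ω p = 0 := by
  simp [sectorCutoff, Set.indicator_of_notMem hp]

/-- `0 ≤ F_{h,ω}(k) ≤ 1`. [cite: BenfattoGiulianiMastropietro2003, §2.3 (3.20a) p.8 (L16–19)] -/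
theorem sectorCutoff_mem_Icc (ε : (Fin 2 → ℝ) → ℝ) (μ : ℝ) {e₀ : ℝ} (he : 0 < e₀) (u : ℝ → ℝ → ℝ)
    (n ω : ℕ) (p : ℝ × (Fin 2 → ℝ)) : sectorCutoff ε μ e₀ u n ω p ∈ Icc (0 : ℝ) 1 := by
  have h1 := scaleCutoff_mem_Icc ε μ he n p
  have h2 : sectorWeightCirc n ω (polarAngle p.2) ∈ Icc (0 : ℝ) 1 :=
    ⟨sectorWeightCirc_nonneg _ _ _, sectorWeightCirc_le_one _ _ _⟩
  have h0 : (shell u e₀).indicator (fun _ => (1 : ℝ)) p.2 ∈ Icc (0 : ℝ) 1 := by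
    by_cases hm : p.2 ∈ shell u e₀
    · simp [Set.indicator_of_mem hm]
    · simp [Set.indicator_of_notMem hm]
  exact ⟨mul_nonneg (mul_nonneg h0.1 h1.1) h2.1,
    mul_le_one₀ (mul_le_one₀ h0.2 h1.1 h1.2) h2.1 h2.2⟩

/-- **The single-scale sector propagator `g^{(h)}_ω(x)`** (3.20), `h = −n ≤ 0`, `ω ∈ O_h`, `x = (x₀, x⃗)`:
`g^{(h)}_ω(x) = (2π)⁻³ ∫ dk₀ dk⃗ e^{-i(k₀x₀ + k⃗·x⃗ − p⃗_F(θ_{h,ω})·x⃗)} F_{h,ω}(k) / (−ik₀ + ε(k⃗) − μ)`, the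
covariance of the field `ψ^{(h)}_ω` with the quasi-particle phase `e^{ip⃗_F(θ_{h,ω})·x⃗}` of (3.12) extracted;
`k₀` continuous and `k⃗` over the shell (module doc, conventions; (3.8a) and p.7 L1–7).
[cite: BenfattoGiulianiMastropietro2003, §2.3 (3.20) p.8 (L10–16)] -/
def sectorPropagator (ε : (Fin 2 → ℝ) → ℝ) (μ e₀ : ℝ) (u : ℝ → ℝ → ℝ) (n ω : ℕ) (x₀ : ℝ)
    (x : Fin 2 → ℝ) : ℂ :=
  ((((2 * π) ^ 3 : ℝ) : ℂ))⁻¹ *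
    ∫ p : ℝ × (Fin 2 → ℝ),
      Complex.exp (-(Complex.I *
          ((p.1 * x₀ + ∑ i : Fin 2, (p.2 i - fermiPoint u (sectorCenter n ω) i) * x i : ℝ) : ℂ))) *
        ((sectorCutoff ε μ e₀ u n ω p : ℝ) : ℂ) /
          (-(Complex.I * (p.1 : ℂ)) + ((ε p.2 - μ : ℝ) : ℂ))

/-- **`g^{(h)}_ω` in the frame adapted to the Fermi curve at `p⃗_F(θ_{h,ω})`** (3.21b):
`(x₀, x'₁, x'₂) ↦ g^{(h)}_ω(x₀, x'₁ n⃗(θ_{h,ω}) + x'₂ τ⃗(θ_{h,ω}))`, with `n⃗`, `τ⃗` of (3.21) (= the `e = 0`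
frame `unitNormal u θ 0`, `unitTangent u θ 0` of `BGM2003Sectors`). [cite: BenfattoGiulianiMastropietro2003, §2.3 (3.21), (3.21b) p.8 (L27–32, L51)] -/
def sectorPropagatorFrame (ε : (Fin 2 → ℝ) → ℝ) (μ e₀ : ℝ) (u : ℝ → ℝ → ℝ) (n ω : ℕ)
    (x₀ x₁ x₂ : ℝ) : ℂ :=
  sectorPropagator ε μ e₀ u n ω x₀
    (x₁ • unitNormal u (sectorCenter n ω) 0 + x₂ • unitTangent u (sectorCenter n ω) 0)

/-- **Mixed partial derivatives** `∂₀^{n₀} ∂₁^{n₁} ∂₂^{n₂} G (x₀, x₁, x₂)` of a function of three real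
variables, as nested one-variable iterated derivatives (innermost variable `x₂`); for `C^∞` functions this is
the classical mixed partial, independent of the nesting order. [folklore] -/
def mixedPartial (n₀ n₁ n₂ : ℕ) (G : ℝ → ℝ → ℝ → ℂ) (x₀ x₁ x₂ : ℝ) : ℂ :=
  iteratedDeriv n₀ (fun t => iteratedDeriv n₁ (fun s => iteratedDeriv n₂ (fun r => G t s r) x₂) x₁) x₀

/-- Order `(0,0,0)` (`m = 0` in (3.22)): no derivative, the bound is on `g^{(h)}_ω` itself. [cite: BenfattoGiulianiMastropietro2003, §2.3 Lemma 2.1 (3.22) p.8 (L57–63), case m = 0] -/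
@[simp] theorem mixedPartial_zero (G : ℝ → ℝ → ℝ → ℂ) : mixedPartial 0 0 0 G = G := by
  funext x₀ x₁ x₂
  simp [mixedPartial]

/-! ### Lemma 2.1 [lm3.1] (3.22): the decay of the sector propagator (named fact) -/

/-- **BGM 2003 Lemma 2.1 [lm3.1], (3.22) — named fact.**  For a dispersion of the class of §1.2
(`DispersionHyp ε μ e₀ u`): «Given the integers `N, m, n₀, n₁, n₂ ≥ 0`, with `m = n₀ + n₁ + n₂`, there exists
a constant `C_{N,m}` such that
`|∂_{x₀}^{n₀} ∂_{x'₁}^{n₁} ∂_{x'₂}^{n₂} g^{(h)}_ω(x)| ≤ C_{N,m} γ^{3h/2} γ^{(n₀+n₁+½n₂)h} / (1 + (γ^h|x₀| + γ^h|x'₁| + γ^{h/2}|x'₂|)^N)`»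
(3.22), for all `h ≤ 0`, `ω ∈ O_h` and `x`, where `x⃗ = x'₁ n⃗(θ_{h,ω}) + x'₂ τ⃗(θ_{h,ω})` (3.21b); here
`γ = 4`, `h = −n`, so `γ^{3h/2}γ^{(n₀+n₁+½n₂)h} = 4^{-n(3/2 + n₀ + n₁ + n₂/2)}`.  The constant depends on the
data `(ε, μ, e₀)` and on `N, n₀, n₁, n₂` only.  (Remark p.8 L65–68: the lemma also holds for non-`C^∞` Fermi
surfaces whose derivatives diverge "not too fast" — not typed.)  Proved in the paper's §7.2 (p.27 L28–52);
unproved here (named fact; for the Hubbard band at order `(0,0,0)` see `sectorPropagator_decay`).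
[cite: BenfattoGiulianiMastropietro2003, §2.3 Lemma 2.1 (3.22) p.8 (L57–68)] -/
def lemma21_sectorPropagatorDecay : Prop :=
  ∀ (ε : (Fin 2 → ℝ) → ℝ) (μ e₀ : ℝ) (u : ℝ → ℝ → ℝ), DispersionHyp ε μ e₀ u →
    ∀ N n₀ n₁ n₂ : ℕ, ∃ C : ℝ, 0 < C ∧ ∀ n ω : ℕ, ω < sectorCount n → ∀ x₀ x₁ x₂ : ℝ,
      ‖mixedPartial n₀ n₁ n₂ (sectorPropagatorFrame ε μ e₀ u n ω) x₀ x₁ x₂‖ ≤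
        C * (4 : ℝ) ^ (-((n : ℝ) * (3 / 2 + (n₀ : ℝ) + (n₁ : ℝ) + (n₂ : ℝ) / 2))) /
          (1 + ((4 : ℝ) ^ (-(n : ℤ)) * |x₀| + (4 : ℝ) ^ (-(n : ℤ)) * |x₁| +
            (2 : ℝ) ^ (-(n : ℤ)) * |x₂|) ^ N)

/-! ### §6: the rotation-invariant (jellium) case -/

/-- **The jellium dispersion** `ε(k⃗) = |k⃗|²/(2m)` (§6 p.25 L8–10; §1.2). [cite: BenfattoGiulianiMastropietro2003, §6 p.25 (L8–10)] -/
def jelliumDispersion (m : ℝ) (k : Fin 2 → ℝ) : ℝ := (k 0 ^ 2 + k 1 ^ 2) / (2 * m)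

/-- **The polar radius of the jellium level curves**: `Σ(e) = {|k⃗|²/2m = μ + e}` is the circle of radius
`u(θ, e) = √(2m(μ + e))` (rotation invariance: `p_F = |p⃗_F(θ)|` does not depend on `θ`, p.25 L11–12).
[cite: BenfattoGiulianiMastropietro2003, §6 p.25 (L8–12) and §7.1 (A1.1)] -/
def jelliumRadius (m μ : ℝ) (_θ e : ℝ) : ℝ := Real.sqrt (2 * m * (μ + e))

/-- **The jellium Fermi momentum** `p_F = √(2mμ)`. [cite: BenfattoGiulianiMastropietro2003, §6 p.25 (L11–12)] -/
def jelliumFermiMomentum (m μ : ℝ) : ℝ := Real.sqrt (2 * m * μ)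

/-- The jellium level curves: `ε(u(θ,e) e⃗_r(θ)) = μ + e` for `μ + e ≥ 0` (item 1 of §1.2 / (A1.1) for the
jellium data). [cite: BenfattoGiulianiMastropietro2003, §7.1 (A1.1) p.26 (L16–22)] -/
theorem jelliumDispersion_levelPoint {m : ℝ} (hm : 0 < m) {μ e : ℝ} (h : 0 ≤ μ + e) (θ : ℝ) :
    jelliumDispersion m (levelPoint (jelliumRadius m μ) θ e) = μ + e := by
  have hs : Real.sqrt (2 * m * (μ + e)) ^ 2 = 2 * m * (μ + e) :=
    Real.sq_sqrt (by positivity)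
  simp only [jelliumDispersion, levelPoint, jelliumRadius, Pi.smul_apply, smul_eq_mul, dir_zero, dir_one]
  rw [mul_pow, mul_pow, ← mul_add, Real.cos_sq_add_sin_sq, mul_one, hs]
  field_simp

/-- The jellium Fermi point is `p⃗_F(θ) = p_F e⃗_r(θ)`. [cite: BenfattoGiulianiMastropietro2003, §6 p.25 (L11–12)] -/
theorem fermiPoint_jelliumRadius (m μ θ : ℝ) :
    fermiPoint (jelliumRadius m μ) θ = jelliumFermiMomentum m μ • dir θ := by
  simp [fermiPoint, levelPoint, jelliumRadius, jelliumFermiMomentum]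

/-- **The Fourier multiplier of `D₁(t)`** (7.5) at the sector centre `θ₀ = θ_{h,ω}`: with
`k⃗' = k⃗ − p_F e⃗_r(θ₀)`, `k'₁ = k⃗'·e⃗_r(θ₀)`, `k'₂ = k⃗'·e⃗_t(θ₀)` (p.25 L45–48: `e⃗_r = n⃗`, `e⃗_t = τ⃗` here) and
`ρ(t) = √((tk'₁ + p_F)² + (tk'₂)²)` (p.25 L48–49),
`m₁(t, k⃗) = (tk'₁ + p_F)/ρ(t) · ((tk'₁ + p_F)k'₁ + t(k'₂)²)/ρ(t)`. [cite: BenfattoGiulianiMastropietro2003, §6 (7.5) p.25 (L80–90)] -/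
def dMultiplier₁ (pF θ₀ t : ℝ) (k : Fin 2 → ℝ) : ℝ :=
  (t * ((k - pF • dir θ₀) ⬝ᵥ dir θ₀) + pF) /
      Real.sqrt ((t * ((k - pF • dir θ₀) ⬝ᵥ dir θ₀) + pF) ^ 2 + (t * ((k - pF • dir θ₀) ⬝ᵥ tdir θ₀)) ^ 2) *
    (((t * ((k - pF • dir θ₀) ⬝ᵥ dir θ₀) + pF) * ((k - pF • dir θ₀) ⬝ᵥ dir θ₀) +
        t * ((k - pF • dir θ₀) ⬝ᵥ tdir θ₀) ^ 2) /
      Real.sqrt ((t * ((k - pF • dir θ₀) ⬝ᵥ dir θ₀) + pF) ^ 2 + (t * ((k - pF • dir θ₀) ⬝ᵥ tdir θ₀)) ^ 2))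

/-- **The Fourier multiplier of `D₂(t)`** (7.5): `m₂(t, k⃗) = tk'₂/ρ(t) · ((tk'₁ + p_F)k'₁ + t(k'₂)²)/ρ(t)`
(notation of `dMultiplier₁`). [cite: BenfattoGiulianiMastropietro2003, §6 (7.5) p.25 (L80–90)] -/
def dMultiplier₂ (pF θ₀ t : ℝ) (k : Fin 2 → ℝ) : ℝ :=
  t * ((k - pF • dir θ₀) ⬝ᵥ tdir θ₀) /
      Real.sqrt ((t * ((k - pF • dir θ₀) ⬝ᵥ dir θ₀) + pF) ^ 2 + (t * ((k - pF • dir θ₀) ⬝ᵥ tdir θ₀)) ^ 2) *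
    (((t * ((k - pF • dir θ₀) ⬝ᵥ dir θ₀) + pF) * ((k - pF • dir θ₀) ⬝ᵥ dir θ₀) +
        t * ((k - pF • dir θ₀) ⬝ᵥ tdir θ₀) ^ 2) /
      Real.sqrt ((t * ((k - pF • dir θ₀) ⬝ᵥ dir θ₀) + pF) ^ 2 + (t * ((k - pF • dir θ₀) ⬝ᵥ tdir θ₀)) ^ 2))

/-- **The jellium sector propagator with `D`-operators inserted**: for interpolation parameters
`t : Fin n₁ → ℝ`, `s : Fin n₂ → ℝ`, the function `D₁^{n₁} D₂^{n₂} g^{(h)}_ω(x)` with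
`D₁^{n₁} = Π_j D₁(t_j)`, `D₂^{n₂} = Π_j D₂(s_j)` ("`D_iⁿ` denotes the product of `n` factors `D_i(t_j)`",
(7.11)), i.e. (3.20) for the jellium data (`ε = |k⃗|²/2m`, `u = √(2m(μ+e))`, `p⃗_F(θ) = p_F e⃗_r(θ)`) with the
factor `Π_j (i m₁(t_j, k⃗)) Π_j (i m₂(s_j, k⃗))` under the `k`-integral (each `D_i(t)` acts by its Fourier
multiplier (7.5); the charge sign is immaterial for (7.11), module doc).  With `n₁ = n₂ = 0` this is the
jellium `g^{(h)}_ω` of (3.20). [cite: BenfattoGiulianiMastropietro2003, §6 (7.5), (7.11) p.25 (L80–90, L116–127)] -/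
def jelliumPropagatorD (m μ e₀ : ℝ) (n ω : ℕ) {n₁ n₂ : ℕ} (t : Fin n₁ → ℝ) (s : Fin n₂ → ℝ)
    (x₀ : ℝ) (x : Fin 2 → ℝ) : ℂ :=
  ((((2 * π) ^ 3 : ℝ) : ℂ))⁻¹ *
    ∫ p : ℝ × (Fin 2 → ℝ),
      Complex.exp (-(Complex.I *
          ((p.1 * x₀ + ∑ i : Fin 2,
              (p.2 i - jelliumFermiMomentum m μ * dir (sectorCenter n ω) i) * x i : ℝ) : ℂ))) *
        (∏ j : Fin n₁,
            (Complex.I * ((dMultiplier₁ (jelliumFermiMomentum m μ) (sectorCenter n ω) (t j) p.2 : ℝ) : ℂ))) *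
        (∏ j : Fin n₂,
            (Complex.I * ((dMultiplier₂ (jelliumFermiMomentum m μ) (sectorCenter n ω) (s j) p.2 : ℝ) : ℂ))) *
        ((sectorCutoff (jelliumDispersion m) μ e₀ (jelliumRadius m μ) n ω p : ℝ) : ℂ) /
          (-(Complex.I * (p.1 : ℂ)) + ((jelliumDispersion m p.2 - μ : ℝ) : ℂ))

/-- Without `D`-insertions the jellium object is the sector propagator (3.20) of the jellium data.
[cite: BenfattoGiulianiMastropietro2003, §2.3 (3.20) p.8 (L10–16) and §6 p.25 (L34–36)] -/
theorem jelliumPropagatorD_nil (m μ e₀ : ℝ) (n ω : ℕ) (x₀ : ℝ) (x : Fin 2 → ℝ) :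
    jelliumPropagatorD m μ e₀ n ω (n₁ := 0) (n₂ := 0) Fin.elim0 Fin.elim0 x₀ x =
      sectorPropagator (jelliumDispersion m) μ e₀ (jelliumRadius m μ) n ω x₀ x := by
  simp only [jelliumPropagatorD, sectorPropagator, Finset.univ_eq_empty, Finset.prod_empty, mul_one,
    fermiPoint_jelliumRadius, Pi.smul_apply, smul_eq_mul]

/-! ### Lemma 6.1 [lm7.1] (7.11): the dimensional bound with `D`-operators (named fact) -/

/-- **BGM 2003 Lemma 6.1 [lm7.1], (7.11) — named fact (jellium model).**  For the jellium data
(`ε(k⃗) = |k⃗|²/2m`, `m > 0`, `0 < e₀ < μ`): «Given non negative integers `N, n₀, n₁, n₂`, `m = n₀ + n₁ + n₂`,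
there exists a constant `C_{N,m}`, such that
`|∂₀^{n₀} D₁^{n₁} D₂^{n₂} g^{(h)}_ω(x)| ≤ C_{N,m} γ^{h(3/2 + n₀ + n₁ + 3n₂/2)} / (1 + [(γ^hx₀)² + (γ^hx₁)² + (γ^{h/2}x₂)²]^N)`
(7.11), where `D_iⁿ` denotes the product of `n` factors `D_i(t_j)`, `j = 1,…,n`» — for all `h ≤ 0`
(`h = −n`, `γ = 4`), `ω ∈ O_h`, all `t_j, s_j ∈ [0,1]` and all `x`, with `x₁ = x⃗·e⃗_r(θ_{h,ω})`,
`x₂ = x⃗·e⃗_t(θ_{h,ω})` (written for `x⃗ = x₁e⃗_r + x₂e⃗_t`), `∂₀` the `x₀`-derivative.  Remark p.25 L129–136: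
each `D_i(t)` improves the bound by at least `γ^h` — a consequence of rotation invariance.  "It is easy to
prove the following dimensional bound" (p.25 L114); unproved here (named fact).
[cite: BenfattoGiulianiMastropietro2003, §6 Lemma 6.1 (7.11) p.25 (L114–136)] -/
def lemma61_jelliumPropagatorDecay : Prop :=
  ∀ m μ e₀ : ℝ, 0 < m → 0 < e₀ → e₀ < μ →
    ∀ N n₀ n₁ n₂ : ℕ, ∃ C : ℝ, 0 < C ∧ ∀ n ω : ℕ, ω < sectorCount n →
      ∀ (t : Fin n₁ → ℝ) (s : Fin n₂ → ℝ), (∀ j, t j ∈ Icc (0 : ℝ) 1) → (∀ j, s j ∈ Icc (0 : ℝ) 1) →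
        ∀ x₀ x₁ x₂ : ℝ,
          ‖iteratedDeriv n₀ (fun τ => jelliumPropagatorD m μ e₀ n ω t s τ
              (x₁ • dir (sectorCenter n ω) + x₂ • tdir (sectorCenter n ω))) x₀‖ ≤
            C * (4 : ℝ) ^ (-((n : ℝ) * (3 / 2 + (n₀ : ℝ) + (n₁ : ℝ) + 3 / 2 * (n₂ : ℝ)))) /
              (1 + (((4 : ℝ) ^ (-(n : ℤ)) * x₀) ^ 2 + ((4 : ℝ) ^ (-(n : ℤ)) * x₁) ^ 2 +
                ((2 : ℝ) ^ (-(n : ℤ)) * x₂) ^ 2) ^ N)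

end BGM2003

end Literature.MathematicalPhysics.QuantumLattice.FermiRG

end
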